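import Summits.RiemannHypothesis.RiemannHypothesis.Theorems.GroundBartaGroundBartaFloorHarmonicSplit
import Summits.RiemannHypothesis.RiemannHypothesis.Theorems.GroundBartaGroundBartaFloorLeakageEnvelope
import Summits.RiemannHypothesis.RiemannHypothesis.Theorems.GroundBartaGroundBartaFloorApproximants
import Summits.RiemannHypothesis.RiemannHypothesis.Theorems.GroundBartaGroundBartaFloorBartaPrelim
import Mathlib.Analysis.SpecialFunctions.SmoothTransition
import HarnessLib

/-!
# The smooth theta window vector (route `RiemannHypothesis/GroundBarta`, rung 3
`PolarPerronFrobenius`, stmt-RiemannHypothesis-18390 — theta-vector toolkit)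

The SMOOTH THETA WINDOW VECTOR of the window `[-a, a]`,

  `Θ_a(t) = Φ(t) · σ((a - t)x) · σ((a + t)x)`,  `x = e^{2a}`, `σ = Real.smoothTransition`,
  `Φ = weilThetaPhi` (Riemann's kernel, `Φ̂ = ξ`),

equals `Φ` on the bulk `|t| ≤ a - e^{-2a}`, vanishes off `(-a, a)`, and is smooth: a Weil test
(`thetaWin_isWeilTest`), even, real, supported in `[-a, a]`.  Its COLLAR TAIL
`κ_a = Φ·(1 - χ_a)` (`χ_a` the smooth plateau cut-off) lies in the strong exponential Weil class
(`thetaWin_tail_class`, by `GroundBartaFloor.stub_leakageKernelEnvelope`), and since Riemann's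
kernel is Weil-harmonic against every test (`stub_harmonicSplit`), the polarised Weil functional of
`Θ_a` against any test `g` is MINUS that of the tail:

  `W(g ⋆ Θ̃_a) = -W(g ⋆ κ̃_a)`  (`weilFunctional_weilConv_weilReflect_thetaWin`).

This is the starting point of the window-image analysis of `Θ_a` (the object of GroundBarta's
`BulkThetaDominance` layer and of item `ThetaWindowImage` of the draft route
`EvenThetaVisibilityPinning`).  RH-free.  References: Bombieri 2000 (explicit formula, Thm 2);
B. Riemann / de Bruijn (the kernel `Φ`).
-/

set_option linter.dupNamespace false

noncomputable section

open Set MeasureTheory Filter Complex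
open scoped Real Topology ComplexConjugate

namespace Summit.RiemannHypothesis.RiemannHypothesis.Theorems.PolarPerronFrobenius

open Literature.NumberTheory.LFunctions
open Summit.RiemannHypothesis.RiemannHypothesis.Theorems.GroundBartaFloor
open Summit.RiemannHypothesis.RiemannHypothesis.Theorems.GroundStatesConvergeToXi

/-- The smooth plateau cut-off `χ_a(t) = σ((a - t)e^{2a}) σ((a + t)e^{2a})` of the window `[-a, a]`. -/
local notation "χ[" a "]" => (fun t : ℝ =>
  Real.smoothTransition ((a - t) * Real.exp (2 * a)) * Real.smoothTransition ((a + t) * Real.exp (2 * a)))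

/-- The smooth theta window vector `Θ_a = Φ χ_a`, complexified, in the spelling of the route files. -/
local notation "Θ[" a "]" => (fun t : ℝ =>
  ((weilThetaPhi t * Real.smoothTransition ((a - t) * Real.exp (2 * a)) *
    Real.smoothTransition ((a + t) * Real.exp (2 * a)) : ℝ) : ℂ))

/-- The collar tail `κ_a = Φ (1 - χ_a)`, complexified. -/
local notation "κ[" a "]" => (fun t : ℝ =>
  ((weilThetaPhi t * (1 - Real.smoothTransition ((a - t) * Real.exp (2 * a)) *
    Real.smoothTransition ((a + t) * Real.exp (2 * a))) : ℝ) : ℂ))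

/-! ## The plateau cut-off -/

/-- `χ_a` is smooth. [folklore] -/
theorem thetaWin_cutoff_contDiff (a : ℝ) : ContDiff ℝ (⊤ : ℕ∞) χ[a] := by
  refine ContDiff.mul ?_ ?_
  · exact Real.smoothTransition.contDiff.comp ((contDiff_const.sub contDiff_id).mul contDiff_const)
  · exact Real.smoothTransition.contDiff.comp ((contDiff_const.add contDiff_id).mul contDiff_const)

/-- `0 ≤ χ_a ≤ 1`. [folklore] -/
theorem thetaWin_cutoff_nonneg_le_one (a t : ℝ) : 0 ≤ χ[a] t ∧ χ[a] t ≤ 1 :=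
  ⟨mul_nonneg (Real.smoothTransition.nonneg _) (Real.smoothTransition.nonneg _),
    mul_le_one₀ (Real.smoothTransition.le_one _) (Real.smoothTransition.nonneg _)
      (Real.smoothTransition.le_one _)⟩

/-- `χ_a` is even. [folklore] -/
theorem thetaWin_cutoff_neg (a t : ℝ) : χ[a] (-t) = χ[a] t := by
  simp only [sub_neg_eq_add, ← sub_eq_add_neg]
  exact mul_comm _ _

/-- `χ_a` vanishes off the open window `(-a, a)`. [folklore] -/
theorem thetaWin_cutoff_eq_zero {a t : ℝ} (ht : t ∉ Ioo (-a) a) : χ[a] t = 0 := by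
  simp only [mem_Ioo, not_and_or, not_lt] at ht
  have hx : 0 < Real.exp (2 * a) := Real.exp_pos _
  rcases ht with h | h
  · have h1 : (a + t) * Real.exp (2 * a) ≤ 0 := mul_nonpos_of_nonpos_of_nonneg (by linarith) hx.le
    simp only [Real.smoothTransition.zero_of_nonpos h1, mul_zero]
  · have h1 : (a - t) * Real.exp (2 * a) ≤ 0 := mul_nonpos_of_nonpos_of_nonneg (by linarith) hx.le
    simp only [Real.smoothTransition.zero_of_nonpos h1, zero_mul]

/-- `χ_a = 1` on the bulk `|t| ≤ a - e^{-2a}`. [folklore] -/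
theorem thetaWin_cutoff_eq_one {a t : ℝ} (ht : |t| ≤ a - Real.exp (-(2 * a))) : χ[a] t = 1 := by
  have hx : 0 < Real.exp (2 * a) := Real.exp_pos _
  have hinv : Real.exp (-(2 * a)) * Real.exp (2 * a) = 1 := by
    rw [← Real.exp_add]; simp
  obtain ⟨h1, h2⟩ := abs_le.1 ht
  have e1 : 1 ≤ (a - t) * Real.exp (2 * a) := by
    calc (1 : ℝ) = Real.exp (-(2 * a)) * Real.exp (2 * a) := hinv.symm
      _ ≤ (a - t) * Real.exp (2 * a) := mul_le_mul_of_nonneg_right (by linarith) hx.le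
  have e2 : 1 ≤ (a + t) * Real.exp (2 * a) := by
    calc (1 : ℝ) = Real.exp (-(2 * a)) * Real.exp (2 * a) := hinv.symm
      _ ≤ (a + t) * Real.exp (2 * a) := mul_le_mul_of_nonneg_right (by linarith) hx.le
  simp only [Real.smoothTransition.one_of_one_le e1, Real.smoothTransition.one_of_one_le e2, mul_one]

/-- `χ_a` has compact support (inside `[-a, a]`). [folklore] -/
theorem thetaWin_cutoff_hasCompactSupport (a : ℝ) : HasCompactSupport χ[a] := by
  refine HasCompactSupport.of_support_subset_isCompact (isCompact_Icc (a := -a) (b := a))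
    (fun t ht => ?_)
  by_contra h
  exact ht (thetaWin_cutoff_eq_zero fun h' => h (Ioo_subset_Icc_self h'))

/-! ## The smooth theta window vector is an even real Weil test of the window -/

/-- `Θ_a = Φ · χ_a` pointwise (as complex functions). [folklore] -/
theorem thetaWin_apply (a t : ℝ) : Θ[a] t = ((weilThetaPhi t * χ[a] t : ℝ) : ℂ) := by
  simp only [mul_assoc]

/-- `Θ_a` vanishes off the open window `(-a, a)`. [folklore] -/
theorem thetaWin_eq_zero {a t : ℝ} (ht : t ∉ Ioo (-a) a) : Θ[a] t = 0 := by
  rw [thetaWin_apply, thetaWin_cutoff_eq_zero ht, mul_zero, Complex.ofReal_zero]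

/-- `Θ_a = Φ` on the bulk `|t| ≤ a - e^{-2a}`. [folklore] -/
theorem thetaWin_eq_phi {a t : ℝ} (ht : |t| ≤ a - Real.exp (-(2 * a))) :
    Θ[a] t = ((weilThetaPhi t : ℝ) : ℂ) := by
  rw [thetaWin_apply, thetaWin_cutoff_eq_one ht, mul_one]

/-- **`Θ_a` is a Weil test function** (smooth with compact support). [folklore] -/
theorem thetaWin_isWeilTest (a : ℝ) : IsWeilTest Θ[a] := by
  have he : Θ[a] = fun t => ((weilThetaPhi t * χ[a] t : ℝ) : ℂ) := funext (thetaWin_apply a)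
  rw [he]
  refine ⟨?_, ?_⟩
  · exact Complex.ofRealCLM.contDiff.comp (contDiff_weilThetaPhi.mul (thetaWin_cutoff_contDiff a))
  · exact ((thetaWin_cutoff_hasCompactSupport a).mul_left).comp_left Complex.ofReal_zero

/-- `Θ_a` is supported in `[-a, a]`. [folklore] -/
theorem thetaWin_tsupport (a : ℝ) : tsupport Θ[a] ⊆ Icc (-a) a := by
  refine closure_minimal (fun t ht => ?_) isClosed_Icc
  by_contra h
  exact ht (thetaWin_eq_zero fun h' => h (Ioo_subset_Icc_self h'))

/-- `Θ_a` is even. [folklore] -/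
theorem thetaWin_even (a t : ℝ) : Θ[a] (-t) = Θ[a] t := by
  rw [thetaWin_apply, thetaWin_apply, weilThetaPhi_neg, thetaWin_cutoff_neg]

/-- `Θ_a` is real-valued. [folklore] -/
theorem thetaWin_im (a t : ℝ) : (Θ[a] t).im = 0 := by
  simp only [Complex.ofReal_im]

/-- `Θ_a` takes values in `[0, Φ]`. [folklore] -/
theorem thetaWin_re_nonneg_le (a t : ℝ) : 0 ≤ (Θ[a] t).re ∧ (Θ[a] t).re ≤ weilThetaPhi t := by
  rw [thetaWin_apply, Complex.ofReal_re]
  obtain ⟨h0, h1⟩ := thetaWin_cutoff_nonneg_le_one a t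
  exact ⟨mul_nonneg (weilThetaPhi_pos t).le h0,
    mul_le_of_le_one_right (weilThetaPhi_pos t).le h1⟩

/-- `‖Θ_a(t)‖ ≤ Φ(0)` (Riemann's kernel is maximal at the origin). [folklore] -/
theorem norm_thetaWin_le (a t : ℝ) : ‖Θ[a] t‖ ≤ weilThetaPhi 0 := by
  obtain ⟨h0, h1⟩ := thetaWin_re_nonneg_le a t
  rw [thetaWin_apply, Complex.norm_real, Real.norm_eq_abs, abs_of_nonneg (by
    rw [thetaWin_apply, Complex.ofReal_re] at h0; exact h0)]
  rw [thetaWin_apply, Complex.ofReal_re] at h1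
  exact h1.trans (gbf_weilThetaPhi_le_zero_val t)

/-! ## The collar tail and the harmonic split -/

/-- `Θ_a = Φ - κ_a` pointwise. [folklore] -/
theorem thetaWin_eq_phi_sub_tail (a : ℝ) :
    Θ[a] = fun t => ((weilThetaPhi t : ℝ) : ℂ) - κ[a] t := by
  funext t
  push_cast
  ring

/-- **The collar tail `κ_a = Φ(1 - χ_a)` lies in the strong exponential Weil class**: smooth with
every derivative `O(e^{-|t|})` (`stub_leakageKernelEnvelope`). [folklore] -/
theorem thetaWin_tail_class (a : ℝ) :
    ContDiff ℝ (⊤ : ℕ∞) κ[a] ∧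
      ∀ k : ℕ, ∃ C : ℝ, ∀ t : ℝ, ‖iteratedDeriv k κ[a] t‖ ≤ C * Real.exp (-(1 * |t|)) := by
  have h := stub_leakageKernelEnvelope χ[a] (thetaWin_cutoff_contDiff a)
    (thetaWin_cutoff_hasCompactSupport a)
  exact h

/-- The collar tail vanishes on the bulk `|t| ≤ a - e^{-2a}`. [folklore] -/
theorem thetaWin_tail_eq_zero {a t : ℝ} (ht : |t| ≤ a - Real.exp (-(2 * a))) : κ[a] t = 0 := by
  have h1 : Real.smoothTransition ((a - t) * Real.exp (2 * a)) *
      Real.smoothTransition ((a + t) * Real.exp (2 * a)) = 1 := thetaWin_cutoff_eq_one ht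
  simp only [h1, sub_self, mul_zero, Complex.ofReal_zero]

/-- Off the open window the collar tail is Riemann's kernel: `κ_a = Φ` for `t ∉ (-a, a)`. [folklore] -/
theorem thetaWin_tail_eq_phi {a t : ℝ} (ht : t ∉ Ioo (-a) a) :
    κ[a] t = ((weilThetaPhi t : ℝ) : ℂ) := by
  have h1 : Real.smoothTransition ((a - t) * Real.exp (2 * a)) *
      Real.smoothTransition ((a + t) * Real.exp (2 * a)) = 0 := thetaWin_cutoff_eq_zero ht
  simp only [h1, sub_zero, mul_one]

/-- `0 ≤ κ_a ≤ Φ` (real values). [folklore] -/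
theorem thetaWin_tail_re_nonneg_le (a t : ℝ) : 0 ≤ (κ[a] t).re ∧ (κ[a] t).re ≤ weilThetaPhi t := by
  obtain ⟨h0, h1⟩ := thetaWin_cutoff_nonneg_le_one a t
  simp only [Complex.ofReal_re]
  exact ⟨mul_nonneg (weilThetaPhi_pos t).le (by linarith),
    mul_le_of_le_one_right (weilThetaPhi_pos t).le (by linarith)⟩

/-- **Harmonic split for the smooth theta window vector**: for every Weil test `g`,
`W(g ⋆ Θ̃_a) = -W(g ⋆ κ̃_a)` — Riemann's kernel is Weil-harmonic against every test
(`stub_harmonicSplit`), so only the collar tail is seen by the form. [folklore] -/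
theorem weilFunctional_weilConv_weilReflect_thetaWin {g : ℝ → ℂ} (hg : IsWeilTest g) (a : ℝ) :
    weilFunctional (weilConv g (weilReflect Θ[a])) = -weilFunctional (weilConv g (weilReflect κ[a])) := by
  obtain ⟨hκc, hκb⟩ := thetaWin_tail_class a
  rw [thetaWin_eq_phi_sub_tail a]
  exact stub_harmonicSplit g κ[a] hg hκc hκb

/-- **The energy of the smooth theta window vector is a collar quantity**:
`Q(Θ_a) = W(Θ_a ⋆ Θ̃_a) = -W(Θ_a ⋆ κ̃_a)`. [folklore] -/
theorem weilQuadratic_thetaWin (a : ℝ) :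
    weilQuadratic Θ[a] = -weilFunctional (weilConv Θ[a] (weilReflect κ[a])) :=
  weilFunctional_weilConv_weilReflect_thetaWin (thetaWin_isWeilTest a) a

end Summit.RiemannHypothesis.RiemannHypothesis.Theorems.PolarPerronFrobenius

end
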